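import Literature.Analysis.FluidPDE.PassiveVectorTensorPropagator
import Literature.Analysis.FluidPDE.PassiveVectorTensorDuality
import Mathlib.Analysis.InnerProductSpace.Adjoint
import HarnessLib

/-!
# The solution propagator of the linear tensor passive-vector problem: value at `t = s` and DUALITY (adjoint = backward propagator)

Analysis/FluidPDE file (all proofs, no definitions, no named facts).  Companion of `PassiveVectorTensorPropagator` (the two-parameter
propagator `Torus.propagator … s t : L² →L[ℝ] L²` of `∂ₜw + (b·∇)w + ∇π = ∇·(𝔸∇w)`, `∇·w = 0`, `U = S ∘ P_σ`) and of
`PassiveVectorTensorDuality` (`exists_const_ae_integral_inner_reversed_eq`: the pairing of a weak solution with a weak solution of the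
ADJOINT problem — transposed tensor `majorTranspose 𝔸`, time-reversed carrier `r ↦ −b(t − r)` — is constant and equals the trace values at
both ends, Temam 1984 Ch. III §1 Lemma 1.2/1.4):

* `Torus.propagator_apply_eq` / `Torus.coeFn_propagator` — inside the window, `U s t y` is the class of the weakly continuous representative,
  at lag `t − s`, of the chosen weak solution from `P_σ y`;
* `Torus.propagator_self` — `U s s = P_σ` (`0 ≤ s ≤ T`);
* `Torus.inner_propagator_eq_inner_propagator_reversed` — **DUALITY**: for `0 ≤ s < t ≤ T`,
  `⟪U[b,𝔸](s,t) y, z⟫ = ⟪y, U[b̃,𝔸ᵀ](0, t−s) z⟫` with `b̃ r = −b(t − r)` (the backward/adjoint problem on the window, written forward);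
* `Torus.adjoint_propagator` — the same as `adjoint (U[b,𝔸](s,t)) = U[b̃,𝔸ᵀ](0,t−s)`;
* carrier bookkeeping for the reversed window: `memLp_top_stLift_reversed_window`, `ae_isWeaklyDivFree_reversed_window`.

Cell `ad-ideate`, crux K1L_D (lead `lead-k1l-onelevel-p1` 16:14:09Z: "T_k† = window map of the backward adjoint problem").

## References
* R. Temam, *Navier–Stokes Equations* (1984), Ch. III §1 Lemma 1.2, Lemma 1.4. [`Temam1984`]
* A. Pazy, *Semigroups of Linear Operators* (1983), Ch. 5 §5.1; Ch. 1 §1.10 (adjoint semigroup). [`Pazy1983`]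
-/

noncomputable section

open MeasureTheory Set Filter Function TopologicalSpace UnitAddTorus
open scoped ENNReal NNReal InnerProductSpace Topology

namespace Literature.Analysis.FluidPDE

namespace Torus

variable {d : Type*} [Fintype d] [DecidableEq d] [Nonempty d]
variable {T : ℝ} {𝔸 : Visc4 d} {lo hi : ℝ} {b : ℝ → UnitAddTorus d → EuclideanSpace ℝ d}

/-! ## Carrier bookkeeping for the reversed window -/

omit [DecidableEq d] [Nonempty d] in
/-- The carrier of the backward problem on the window `[s,t]`, `r ↦ −b(t − r)`, is essentially bounded on `(0, t − s) × T^d`.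
[cite: Temam1984, Ch. III §1 Lemma 1.2] -/
theorem memLp_top_stLift_reversed_window
    (hb : MemLp (FunctionSpaces.Torus.stLift b) ∞ (volume.restrict (Ioo 0 T ×ˢ univ))) {s t : ℝ} (hs : 0 ≤ s)
    (htT : t ≤ T) :
    MemLp (FunctionSpaces.Torus.stLift (fun r => -b (t - r))) ∞ (volume.restrict (Ioo 0 (t - s) ×ˢ univ)) := by
  -- shift to the window `[s, T)` (carrier `τ ↦ b (s + τ)` on `(0, T − s)`), then reflect at `t − s`
  have h1 : MemLp (FunctionSpaces.Torus.stLift (fun τ => b (s + τ))) ∞ (volume.restrict (Ioo 0 (T - s) ×ˢ univ)) := by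
    -- as in `PassiveVectorTensorPropagator` (translation is measure preserving)
    set θ : ℝ × EuclideanSpace ℝ d → ℝ × EuclideanSpace ℝ d := fun p => (s + p.1, p.2) with hθ
    have hθmp : MeasurePreserving θ (volume : Measure (ℝ × EuclideanSpace ℝ d)) volume := by
      have h := (measurePreserving_add_left (volume : Measure ℝ) s).prod
        (MeasurePreserving.id (volume : Measure (EuclideanSpace ℝ d)))
      have e : Prod.map (fun t : ℝ => s + t) id = θ := by
        funext p; rfl
      rw [e] at h
      exact h
    have hpre : θ ⁻¹' (Ioo s T ×ˢ univ) = Ioo 0 (T - s) ×ˢ univ := by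
      ext p
      simp only [hθ, mem_preimage, mem_prod, mem_univ, and_true, mem_Ioo]
      constructor <;> rintro ⟨h1, h2⟩ <;> constructor <;> linarith
    have hθr : MeasurePreserving θ (volume.restrict (Ioo 0 (T - s) ×ˢ univ)) (volume.restrict (Ioo s T ×ˢ univ)) := by
      have h := hθmp.restrict_preimage (measurableSet_Ioo.prod MeasurableSet.univ) (s := Ioo s T ×ˢ univ)
      rwa [hpre] at h
    have hb₀ : MemLp (FunctionSpaces.Torus.stLift b) ∞ (volume.restrict (Ioo s T ×ˢ univ)) :=
      hb.mono_measure (Measure.restrict_mono (prod_mono (Ioo_subset_Ioo hs le_rfl) le_rfl) le_rfl)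
    have e : FunctionSpaces.Torus.stLift (fun τ => b (s + τ)) = FunctionSpaces.Torus.stLift b ∘ θ := by
      funext p
      simp only [FunctionSpaces.Torus.stLift, hθ, Function.comp_apply]
    rw [e]
    exact hb₀.comp_measurePreserving hθr
  have h2 := memLp_top_stLift_reversed (t₀ := t - s) h1 (sub_le_sub_right htT s)
  have e : (fun r => -(fun τ => b (s + τ)) (t - s - r)) = fun r => -b (t - r) := by
    funext r; show -b (s + (t - s - r)) = -b (t - r); congr 2; ring
  rw [e] at h2
  exact h2

omit [DecidableEq d] [Nonempty d] in
/-- The carrier of the backward problem on the window is weakly divergence free for a.e. time (reflection is measure preserving).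
[cite: Temam1984, Ch. III §1 Lemma 1.2] -/
theorem ae_isWeaklyDivFree_reversed_window
    (hbdiv : ∀ᵐ τ ∂(volume.restrict (Ioo 0 T)), FunctionSpaces.Torus.IsWeaklyDivFree (b τ)) {s t : ℝ} (hs : 0 ≤ s)
    (htT : t ≤ T) :
    ∀ᵐ r ∂(volume.restrict (Ioo 0 (t - s))), FunctionSpaces.Torus.IsWeaklyDivFree (-b (t - r)) := by
  -- `r ↦ t − r` maps `(0, t − s)` onto `(s, t) ⊆ (0, T)`; reflection is measure preserving
  have h1 : ∀ᵐ τ ∂(volume.restrict (Ioo s t)), FunctionSpaces.Torus.IsWeaklyDivFree (b τ) :=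
    ae_restrict_of_ae_restrict_of_subset (Ioo_subset_Ioo hs htT) hbdiv
  have hmp : MeasurePreserving (fun r : ℝ => t - r) (volume.restrict (Ioo 0 (t - s))) (volume.restrict (Ioo s t)) := by
    have h := (Measure.measurePreserving_sub_left (volume : Measure ℝ) t).restrict_preimage (measurableSet_Ioo (a := s) (b := t))
    have hpre : (fun r : ℝ => t - r) ⁻¹' Ioo s t = Ioo 0 (t - s) := by
      ext r; simp only [mem_preimage, mem_Ioo]; constructor <;> rintro ⟨h1, h2⟩ <;> constructor <;> linarith
    rwa [hpre] at h
  have h2 := hmp.quasiMeasurePreserving.ae h1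
  filter_upwards [h2] with r hr
  intro θ hθ
  have e : ∫ x, ⟪(-b (t - r)) x, FunctionSpaces.Torus.gradient θ x⟫_ℝ = -∫ x, ⟪b (t - r) x, FunctionSpaces.Torus.gradient θ x⟫_ℝ := by
    rw [← integral_neg]
    exact integral_congr_ae (ae_of_all _ fun x => by simp only [Pi.neg_apply, inner_neg_left])
  rw [e, hr θ hθ, neg_zero]

/-! ## The propagator inside the window and at `t = s` -/

/-- Inside the window the propagator is the window map at lag `t − s` (unfolding the definition). [cite: Pazy1983, Ch. 5 §5.1 Def. 5.3] -/
theorem propagator_apply_eq (h𝔸 : NearIso 𝔸 lo hi) (hlo : 0 < lo)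
    (hb : MemLp (FunctionSpaces.Torus.stLift b) ∞ (volume.restrict (Ioo 0 T ×ˢ univ)))
    (hbdiv : ∀ᵐ t ∂(volume.restrict (Ioo 0 T)), FunctionSpaces.Torus.IsWeaklyDivFree (b t))
    {s t : ℝ} (hs : 0 ≤ s) (hsT : s < T) (hst : s ≤ t) (htT : t ≤ T)
    (y : Lp (EuclideanSpace ℝ d) 2 (volume : Measure (UnitAddTorus d))) :
    propagator h𝔸 hlo hb hbdiv s t y = windowMapFun h𝔸 hlo hb hbdiv hs hsT (sub_nonneg.2 hst) (τ := t - s) y := by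
  have h : 0 ≤ s ∧ s < T ∧ s ≤ t ∧ t ≤ T := ⟨hs, hsT, hst, htT⟩
  unfold propagator
  rw [dif_pos h]
  rfl

/-- Inside the window, `U s t y` is a.e. the weakly continuous representative, at lag `t − s`, of the chosen weak solution on `[s,T)`
from the datum `P_σ y`. [cite: Temam1984, Ch. III §1 Lemma 1.4] -/
theorem coeFn_propagator (h𝔸 : NearIso 𝔸 lo hi) (hlo : 0 < lo)
    (hb : MemLp (FunctionSpaces.Torus.stLift b) ∞ (volume.restrict (Ioo 0 T ×ˢ univ)))
    (hbdiv : ∀ᵐ t ∂(volume.restrict (Ioo 0 T)), FunctionSpaces.Torus.IsWeaklyDivFree (b t))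
    {s t : ℝ} (hs : 0 ≤ s) (hsT : s < T) (hst : s ≤ t) (htT : t ≤ T)
    (y : Lp (EuclideanSpace ℝ d) 2 (volume : Measure (UnitAddTorus d))) :
    ((propagator h𝔸 hlo hb hbdiv s t y : Lp (EuclideanSpace ℝ d) 2 volume) : UnitAddTorus d → EuclideanSpace ℝ d) =ᵐ[volume]
      windowRep h𝔸 hlo hb hbdiv hs hsT (Lp.memLp ((divFreeL2 d).starProjection y)) (isWeaklyDivFree_starProjection y) (t - s) := by
  rw [propagator_apply_eq h𝔸 hlo hb hbdiv hs hsT hst htT]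
  exact MemLp.coeFn_toLp _

/-- **`U s s = P_σ`** for `0 ≤ s ≤ T`: at zero lag the propagator is the orthogonal projection onto the divergence-free classes
(the representative at time `0` is the datum `P_σ y`). [cite: Pazy1983, Ch. 5 §5.1 Def. 5.3] -/
theorem propagator_self (h𝔸 : NearIso 𝔸 lo hi) (hlo : 0 < lo)
    (hb : MemLp (FunctionSpaces.Torus.stLift b) ∞ (volume.restrict (Ioo 0 T ×ˢ univ)))
    (hbdiv : ∀ᵐ t ∂(volume.restrict (Ioo 0 T)), FunctionSpaces.Torus.IsWeaklyDivFree (b t))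
    {s : ℝ} (hs : 0 ≤ s) (hsT : s ≤ T) (y : Lp (EuclideanSpace ℝ d) 2 (volume : Measure (UnitAddTorus d))) :
    propagator h𝔸 hlo hb hbdiv s s y = (divFreeL2 d).starProjection y := by
  set P := (divFreeL2 d).starProjection with hP
  -- `U s s y = U s s (P y) = P y` (the propagator only sees `P y`, and is the identity on divergence-free data at lag `0`)
  have h1 : propagator h𝔸 hlo hb hbdiv s s (P y) = P y :=
    propagator_self_of_divFree h𝔸 hlo hb hbdiv s hs hsT (P y) (isWeaklyDivFree_starProjection y)
  have h2 : propagator h𝔸 hlo hb hbdiv s s (y - P y) = 0 := by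
    refine propagator_eq_zero_of_orth h𝔸 hlo hb hbdiv s s (y - P y) fun z hz => ?_
    exact (divFreeL2 d).starProjection_inner_eq_zero y z ((mem_divFreeL2_iff z).2 hz)
  calc propagator h𝔸 hlo hb hbdiv s s y = propagator h𝔸 hlo hb hbdiv s s (P y + (y - P y)) := by rw [add_sub_cancel]
    _ = P y := by rw [map_add, h1, h2, add_zero]

/-! ## Duality: the adjoint of the propagator is the propagator of the backward (adjoint) problem -/

omit [DecidableEq d] [Nonempty d] in
/-- `⟪toLp f, z⟫ = ∫⟪f, z⟫` for `f ∈ L²`. [folklore] -/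
private theorem inner_toLp_left' {f : UnitAddTorus d → EuclideanSpace ℝ d} (hf : MemLp f 2 volume)
    (z : Lp (EuclideanSpace ℝ d) 2 (volume : Measure (UnitAddTorus d))) :
    ⟪hf.toLp f, z⟫_ℝ = ∫ x, ⟪f x, (z : UnitAddTorus d → EuclideanSpace ℝ d) x⟫_ℝ := by
  rw [MeasureTheory.L2.inner_def]
  exact integral_congr_ae (hf.coeFn_toLp.mono fun x hx => by simp only [hx])

/-- **DUALITY OF THE PROPAGATORS.**  For `0 ≤ s < t ≤ T` and all `y, z ∈ L²`:
`⟪U[b,𝔸](s,t) y, z⟫ = ⟪y, U[b̃, 𝔸ᵀ](0, t − s) z⟫`, where `U[b̃,𝔸ᵀ]` is the propagator (horizon `t − s`) of the ADJOINT problem on the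
window written forward: tensor `majorTranspose 𝔸`, carrier `b̃ r = −b(t − r)`.  Proof: both propagators factor through `P_σ` and have
divergence-free range, so one may assume `y, z` divergence free; then `U y` and `Ũ z` are the classes of the weakly continuous
representatives at lag `t − s` of the weak solutions `u` (from `P_σ y`, along `b(s+·)`) and `ψ` (from `P_σ z`, adjoint problem), and
`PassiveVectorTensorDuality.exists_const_ae_integral_inner_reversed_eq` says the constant pairing `∫⟪u(σ), ψ(t−s−σ)⟫` equals BOTH
`∫⟪W_u(t−s), P_σ z⟫` and `∫⟪Ψ(t−s), P_σ y⟫` (continuous representatives of the two trace pairings, evaluated at the endpoint).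
[cite: Temam1984, Ch. III §1 Lemma 1.2] [cite: Pazy1983, Ch. 1 §1.10 (adjoint semigroup)] -/
theorem inner_propagator_eq_inner_propagator_reversed (h𝔸 : NearIso 𝔸 lo hi) (hlo : 0 < lo)
    (hb : MemLp (FunctionSpaces.Torus.stLift b) ∞ (volume.restrict (Ioo 0 T ×ˢ univ)))
    (hbdiv : ∀ᵐ τ ∂(volume.restrict (Ioo 0 T)), FunctionSpaces.Torus.IsWeaklyDivFree (b τ))
    {s t : ℝ} (hs : 0 ≤ s) (hst : s < t) (htT : t ≤ T)
    (h𝔸' : NearIso (majorTranspose 𝔸) lo hi)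
    (hb' : MemLp (FunctionSpaces.Torus.stLift (fun r => -b (t - r))) ∞ (volume.restrict (Ioo 0 (t - s) ×ˢ univ)))
    (hbdiv' : ∀ᵐ r ∂(volume.restrict (Ioo 0 (t - s))), FunctionSpaces.Torus.IsWeaklyDivFree (-b (t - r)))
    (y z : Lp (EuclideanSpace ℝ d) 2 (volume : Measure (UnitAddTorus d))) :
    ⟪propagator h𝔸 hlo hb hbdiv s t y, z⟫_ℝ =
      ⟪y, propagator (T := t - s) (b := fun r => -b (t - r)) h𝔸' hlo hb' hbdiv' 0 (t - s) z⟫_ℝ := by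
  set P := (divFreeL2 d).starProjection with hP
  have hsT : s < T := hst.trans_le htT
  have ht₀ : 0 < t - s := sub_pos.2 hst
  -- data
  have hy : MemLp ((P y : Lp (EuclideanSpace ℝ d) 2 volume) : UnitAddTorus d → EuclideanSpace ℝ d) 2 volume := Lp.memLp _
  have hz : MemLp ((P z : Lp (EuclideanSpace ℝ d) 2 volume) : UnitAddTorus d → EuclideanSpace ℝ d) 2 volume := Lp.memLp _
  have hyd := isWeaklyDivFree_starProjection (d := d) y
  have hzd := isWeaklyDivFree_starProjection (d := d) z
  -- forward: solution `u` on `[s,T)` from `P y`, representative `W`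
  have hu := windowSol_spec h𝔸 hlo hb hbdiv hs hsT hy hyd
  have RW := windowRep_spec h𝔸 hlo hb hbdiv hs hsT hy hyd
  set u := windowSol h𝔸 hlo hb hbdiv hs hsT hy hyd with hu_def
  set W := windowRep h𝔸 hlo hb hbdiv hs hsT hy hyd with hW_def
  -- backward: solution `ψ` on `[0, t − s)` of the adjoint problem from `P z`, representative `Ψ`
  have hψ₀ := windowSol_spec (T := t - s) (b := fun r => -b (t - r)) h𝔸' hlo hb' hbdiv' le_rfl ht₀ hz hzd
  have RΨ := windowRep_spec (T := t - s) (b := fun r => -b (t - r)) h𝔸' hlo hb' hbdiv' le_rfl ht₀ hz hzd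
  set ψ := windowSol (T := t - s) (b := fun r => -b (t - r)) h𝔸' hlo hb' hbdiv' le_rfl ht₀ hz hzd with hψ_def
  set Ψ := windowRep (T := t - s) (b := fun r => -b (t - r)) h𝔸' hlo hb' hbdiv' le_rfl ht₀ hz hzd with hΨ_def
  -- `ψ` in the form required by the duality theorem (carrier `r ↦ −(b(s + ·)) (t − s − r)`, horizon `t − s`)
  have e1 : t - s - 0 = t - s := sub_zero _
  have e2 : (fun τ => (fun r => -b (t - r)) (0 + τ)) = fun r => -(fun τ => b (s + τ)) (t - s - r) := by
    funext r; show -b (t - (0 + r)) = -b (s + (t - s - r)); congr 2; ring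
  have hψ : IsWeakTensorPassiveVectorOn 0 (t - s) (majorTranspose 𝔸) (fun r => -(fun τ => b (s + τ)) (t - s - r))
      ((P z : Lp (EuclideanSpace ℝ d) 2 volume) : UnitAddTorus d → EuclideanSpace ℝ d) ψ := by
    have h := hψ₀
    rw [e1, e2] at h
    exact h
  -- the shifted forward carrier is bounded
  have hbs : MemLp (FunctionSpaces.Torus.stLift (fun τ => b (s + τ))) ∞ (volume.restrict (Ioo 0 (T - s) ×ˢ univ)) := by
    set θ : ℝ × EuclideanSpace ℝ d → ℝ × EuclideanSpace ℝ d := fun p => (s + p.1, p.2) with hθ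
    have hθmp : MeasurePreserving θ (volume : Measure (ℝ × EuclideanSpace ℝ d)) volume := by
      have h := (measurePreserving_add_left (volume : Measure ℝ) s).prod
        (MeasurePreserving.id (volume : Measure (EuclideanSpace ℝ d)))
      have e : Prod.map (fun t : ℝ => s + t) id = θ := by
        funext p; rfl
      rw [e] at h
      exact h
    have hpre : θ ⁻¹' (Ioo s T ×ˢ univ) = Ioo 0 (T - s) ×ˢ univ := by
      ext p
      simp only [hθ, mem_preimage, mem_prod, mem_univ, and_true, mem_Ioo]
      constructor <;> rintro ⟨h1, h2⟩ <;> constructor <;> linarith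
    have hθr : MeasurePreserving θ (volume.restrict (Ioo 0 (T - s) ×ˢ univ)) (volume.restrict (Ioo s T ×ˢ univ)) := by
      have h := hθmp.restrict_preimage (measurableSet_Ioo.prod MeasurableSet.univ) (s := Ioo s T ×ˢ univ)
      rwa [hpre] at h
    have hb₀ : MemLp (FunctionSpaces.Torus.stLift b) ∞ (volume.restrict (Ioo s T ×ˢ univ)) :=
      hb.mono_measure (Measure.restrict_mono (prod_mono (Ioo_subset_Ioo hs le_rfl) le_rfl) le_rfl)
    have e : FunctionSpaces.Torus.stLift (fun τ => b (s + τ)) = FunctionSpaces.Torus.stLift b ∘ θ := by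
      funext p
      simp only [FunctionSpaces.Torus.stLift, hθ, Function.comp_apply]
    rw [e]
    exact hb₀.comp_measurePreserving hθr
  -- THE DUALITY CONSTANT and its two endpoint identifications
  obtain ⟨c, -, hcg, hch⟩ := hu.exists_const_ae_integral_inner_reversed_eq ht₀ (sub_le_sub_right htT s) hψ h𝔸 hlo
    hy hyd hz hzd hbs
  -- forward endpoint: `g σ := ∫⟪W σ, P z⟫` is continuous on `[0, T − s]` and a.e. equal to `∫⟪u σ, P z⟫`
  have hgW : (∫ x, ⟪W (t - s) x, ((P z : Lp (EuclideanSpace ℝ d) 2 volume) : UnitAddTorus d → EuclideanSpace ℝ d) x⟫_ℝ) = c := by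
    refine hcg (fun σ => ∫ x, ⟪W σ x, ((P z : Lp (EuclideanSpace ℝ d) 2 volume) : UnitAddTorus d → EuclideanSpace ℝ d) x⟫_ℝ)
      (RW.2.2.2.2.2.1 _ hz) ?_
    filter_upwards [RW.2.2.2.1] with σ hσ
    exact integral_congr_ae (hσ.mono fun x hx => by simp only [hx])
  -- backward endpoint: `h r := ∫⟪Ψ r, P y⟫`
  have hhΨ : (∫ x, ⟪Ψ (t - s) x, ((P y : Lp (EuclideanSpace ℝ d) 2 volume) : UnitAddTorus d → EuclideanSpace ℝ d) x⟫_ℝ) = c := by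
    refine hch (fun r => ∫ x, ⟪Ψ r x, ((P y : Lp (EuclideanSpace ℝ d) 2 volume) : UnitAddTorus d → EuclideanSpace ℝ d) x⟫_ℝ) ?_ ?_
    · have h := RΨ.2.2.2.2.2.1 _ hy
      rw [e1] at h
      exact h
    · have h := RΨ.2.2.2.1
      rw [e1] at h
      filter_upwards [h] with r hr
      exact integral_congr_ae (hr.mono fun x hx => by simp only [hx])
  -- the two propagator values as classes of the representatives
  have hUy : propagator h𝔸 hlo hb hbdiv s t y =
      (memLp_windowRep h𝔸 hlo hb hbdiv hs hsT hy hyd (sub_nonneg.2 hst.le)).toLp (W (t - s)) := by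
    rw [propagator_apply_eq h𝔸 hlo hb hbdiv hs hsT hst.le htT]
    rfl
  have hUz : propagator (T := t - s) (b := fun r => -b (t - r)) h𝔸' hlo hb' hbdiv' 0 (t - s) z =
      (memLp_windowRep (T := t - s) (b := fun r => -b (t - r)) h𝔸' hlo hb' hbdiv' le_rfl ht₀ hz hzd
        (sub_nonneg.2 ht₀.le : (0 : ℝ) ≤ t - s - 0)).toLp (Ψ (t - s - 0)) := by
    rw [propagator_apply_eq (T := t - s) (b := fun r => -b (t - r)) h𝔸' hlo hb' hbdiv' le_rfl ht₀ ht₀.le le_rfl]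
    rfl
  -- range in `divFreeL2`: pair against `P z` / `P y` instead of `z` / `y`
  have hUyK : propagator h𝔸 hlo hb hbdiv s t y ∈ divFreeL2 d := (mem_divFreeL2_iff _).2 (propagator_divFree h𝔸 hlo hb hbdiv s t y)
  have hUzK : propagator (T := t - s) (b := fun r => -b (t - r)) h𝔸' hlo hb' hbdiv' 0 (t - s) z ∈ divFreeL2 d :=
    (mem_divFreeL2_iff _).2 (propagator_divFree (T := t - s) (b := fun r => -b (t - r)) h𝔸' hlo hb' hbdiv' 0 (t - s) z)
  have k1 : ⟪propagator h𝔸 hlo hb hbdiv s t y, z⟫_ℝ = ⟪propagator h𝔸 hlo hb hbdiv s t y, P z⟫_ℝ := by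
    rw [← sub_eq_zero, ← inner_sub_right]
    exact Submodule.inner_right_of_mem_orthogonal hUyK ((divFreeL2 d).sub_starProjection_mem_orthogonal z)
  have k2 : ⟪propagator (T := t - s) (b := fun r => -b (t - r)) h𝔸' hlo hb' hbdiv' 0 (t - s) z, y⟫_ℝ =
      ⟪propagator (T := t - s) (b := fun r => -b (t - r)) h𝔸' hlo hb' hbdiv' 0 (t - s) z, P y⟫_ℝ := by
    rw [← sub_eq_zero, ← inner_sub_right]
    exact Submodule.inner_right_of_mem_orthogonal hUzK ((divFreeL2 d).sub_starProjection_mem_orthogonal y)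
  calc ⟪propagator h𝔸 hlo hb hbdiv s t y, z⟫_ℝ = ⟪propagator h𝔸 hlo hb hbdiv s t y, P z⟫_ℝ := k1
    _ = ∫ x, ⟪W (t - s) x, ((P z : Lp (EuclideanSpace ℝ d) 2 volume) : UnitAddTorus d → EuclideanSpace ℝ d) x⟫_ℝ := by
        rw [hUy, inner_toLp_left']
    _ = c := hgW
    _ = ∫ x, ⟪Ψ (t - s - 0) x, ((P y : Lp (EuclideanSpace ℝ d) 2 volume) : UnitAddTorus d → EuclideanSpace ℝ d) x⟫_ℝ := by
        rw [e1]; exact hhΨ.symm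
    _ = ⟪propagator (T := t - s) (b := fun r => -b (t - r)) h𝔸' hlo hb' hbdiv' 0 (t - s) z, P y⟫_ℝ := by
        rw [hUz, inner_toLp_left']
    _ = ⟪propagator (T := t - s) (b := fun r => -b (t - r)) h𝔸' hlo hb' hbdiv' 0 (t - s) z, y⟫_ℝ := k2.symm
    _ = ⟪y, propagator (T := t - s) (b := fun r => -b (t - r)) h𝔸' hlo hb' hbdiv' 0 (t - s) z⟫_ℝ := real_inner_comm _ _

/-- **The adjoint of the propagator is the backward propagator**: `(U[b,𝔸](s,t))† = U[b̃, 𝔸ᵀ](0, t − s)`, `b̃ r = −b(t − r)`,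
for `0 ≤ s < t ≤ T`. [cite: Temam1984, Ch. III §1 Lemma 1.2] [cite: Pazy1983, Ch. 1 §1.10 (adjoint semigroup)] -/
theorem adjoint_propagator (h𝔸 : NearIso 𝔸 lo hi) (hlo : 0 < lo)
    (hb : MemLp (FunctionSpaces.Torus.stLift b) ∞ (volume.restrict (Ioo 0 T ×ˢ univ)))
    (hbdiv : ∀ᵐ τ ∂(volume.restrict (Ioo 0 T)), FunctionSpaces.Torus.IsWeaklyDivFree (b τ))
    {s t : ℝ} (hs : 0 ≤ s) (hst : s < t) (htT : t ≤ T)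
    (h𝔸' : NearIso (majorTranspose 𝔸) lo hi)
    (hb' : MemLp (FunctionSpaces.Torus.stLift (fun r => -b (t - r))) ∞ (volume.restrict (Ioo 0 (t - s) ×ˢ univ)))
    (hbdiv' : ∀ᵐ r ∂(volume.restrict (Ioo 0 (t - s))), FunctionSpaces.Torus.IsWeaklyDivFree (-b (t - r))) :
    ContinuousLinearMap.adjoint (propagator h𝔸 hlo hb hbdiv s t) =
      propagator (T := t - s) (b := fun r => -b (t - r)) h𝔸' hlo hb' hbdiv' 0 (t - s) := by
  symm
  rw [ContinuousLinearMap.eq_adjoint_iff]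
  intro z y
  rw [real_inner_comm, ← inner_propagator_eq_inner_propagator_reversed h𝔸 hlo hb hbdiv hs hst htT h𝔸' hb' hbdiv' y z,
    real_inner_comm]

/-- **The duality identity with the carrier facts supplied** (`0 ≤ s < t ≤ T`; the backward carrier's bound and divergence-freeness
are derived from those of `b`). [cite: Temam1984, Ch. III §1 Lemma 1.2] -/
theorem adjoint_propagator' (h𝔸 : NearIso 𝔸 lo hi) (hlo : 0 < lo)
    (hb : MemLp (FunctionSpaces.Torus.stLift b) ∞ (volume.restrict (Ioo 0 T ×ˢ univ)))
    (hbdiv : ∀ᵐ τ ∂(volume.restrict (Ioo 0 T)), FunctionSpaces.Torus.IsWeaklyDivFree (b τ))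
    {s t : ℝ} (hs : 0 ≤ s) (hst : s < t) (htT : t ≤ T) :
    ContinuousLinearMap.adjoint (propagator h𝔸 hlo hb hbdiv s t) =
      propagator (T := t - s) (b := fun r => -b (t - r)) ((nearIso_majorTranspose_iff 𝔸 lo hi).2 h𝔸) hlo
        (memLp_top_stLift_reversed_window hb hs htT) (ae_isWeaklyDivFree_reversed_window hbdiv hs htT) 0 (t - s) :=
  adjoint_propagator h𝔸 hlo hb hbdiv hs hst htT _ _ _

end Torus

end Literature.Analysis.FluidPDE

end
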